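import Literature.MathematicalPhysics.QuantumFieldTheory.Balaban1983to89.B8Eq127LandauGauge

/-!
# `Balaban1983to89.B8Eq138Multiplier` — T. Bałaban, *Spaces of regular gauge field configurations on a lattice and gauge
# fixing conditions*, Commun. Math. Phys. **99** (1985) 75–102 [Balaban1985RegularSpaces] ("B8"), (1.38)/(1.42)/(1.146)
# «R(U₀)D^{η*}_{U₀}A = 0 / = f»: THE LAGRANGE-MULTIPLIER FORM «Δ^η_{U₀}(D^{η*}_{U₀}A) ∈ Ran Q′(U₀)*», proved equivalent to
# the printed projection form from the (3.25)-inverses of [4] = [Balaban1985BackgroundPropagators] ALONE (no scalar product)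

statement-level skeleton of published theorems with citation tags; proofs where landed; nothing here is a claim about the
Yang–Mills mass gap

PDF held: `paper:balaban1985-cmp99-regular-spaces-gauge-fixing` (journal page = PDF page + 74), p. 80 (1.27), p. 82 (1.38),
p. 101 (1.146); [4] T. Bałaban, *Propagators for lattice gauge theories in a background field*, CMP **99** (1985) 389–434
[Balaban1985BackgroundPropagators] p. 394 (3.21)–(3.25), both read through the tree modules `B9Eq325Proj` (pass 6 of cell
`pub-balaban`) and `B8Eq127LandauGauge` (cell `lit-balaban` r05): the quotations below are theirs.

WHAT IS PRINTED.  [B8] p. 80: *"An operator R(U₀) is defined as an orthogonal projection in this real Hilbert space, onto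
the subspace Δ^η_{U₀}N(Q′(U₀)). The Landau gauge condition … R(U₀)D^{η*}_{U₀}(1/i) log U′ = 0. (1.27)"*; p. 82 (1.38)
*"R(U₀)D^{η*}_{U₀}A = 0"*; p. 101 (1.146) *"R(U₀)D^{η*}_{U₀}A = f"*.  [4] p. 394: *"Using the Lagrange multipliers method the
minimum of (3.22) can be found by the same calculations as in [4], (2.15)–(2.17), and we obtain the formula
Rf = (I − G′Q′\*(Q′G′²Q′\*)^{−1}Q′G′)f, (3.25) where G′ = G′(U) = (Δ′_a)^{−1}"*, Δ′_a = Δ^η_U + Q′\*aQ′ ((3.24)).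

WHY THIS FILE (cell `pub-ymgap`, seat `pub-ymgap-dag-n05-a` g4 = the KNIT seat of DAG node N05 = [B8]; interface I-B8-1/2 of
`lit-balaban` r05's INTERFACES-B8: «once B8's ℤᵈ/𝔸 carriers are given a real pairing»).  The knit of Theorem 4 on the
concrete `ℤᵈ × 𝔸` carriers (`B8Thm4InductionLocal.thm4_exists_all_levels`, `B8Thm4UniqueLocal.thm4_unique_of_agree`) reads
the Landau equation (1.38) as an ARBITRARY predicate `Lan`, because the printed R(U₀) needs the real scalar product of
L²(Ω₀, 𝔤), which those carriers (a general C⋆-algebra `𝔸`) do not carry.  This file records the inner-product-FREE form of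
the same condition: for the operator R of (3.25), built from ANY two-sided inverse G′ of Δ′_a and ANY left inverse of
Q′G′²Q′\*,
  «R f = 0  ⟺  ∃ μ, Δ f = Q′\* μ»   (`proj325_apply_eq_zero_iff_exists`),
by four lines of algebra (Δ′_a G′ = 1 gives «⇒» with μ := (Q′G′²Q′\*)^{−1}Q′G′f − aQ′f; G′Δ′_a = 1 and the left inverse give
«⇐»).  No symmetry of Δ, no adjointness of Q′\*, no positivity and no completeness is used, so the statement is typed over
an arbitrary ring of scalars and arbitrary modules — it applies verbatim to `ℂ`-linear operators on `𝔸`-valued lattice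
functions.  Consequently (1.38) can be TYPED on any carrier as «Δ^η_{U₀}(D^{η*}_{U₀}A) = Q′(U₀)ᵀμ for some μ on 𝔅_k» (Q′ᵀ the
transpose stencil of the linearised averaging with inverted transporters), and its identification with print's projection
form consumes exactly the existence of the (3.25)-inverses — [4] Theorem 3.11, the in-edge b9 of the node — and nothing
else.  §2 then records the corollaries in the scalar-product setting of the tree: under `B9Eq325Proj.Data` the variational
condition `B8Eq127LandauGauge.IsLandauBG` (⟺ «R X = 0», r05) is the multiplier condition, the source form (1.146)
`IsLandauSrc` likewise; the direction «multiplier ⇒ variational» needs only Δ symmetric and Q′\* adjoint to Q′ (no inverses);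
§3 on the finite lattice carriers of [4] (`B9Thm311Lattice`), where the (3.25)-data exist for every background
(`obvious_311_lattice`), (1.27)/(1.38)/(1.146) ARE the multiplier conditions with `LinearMap.adjoint (qL …)` outright.

WHAT THIS FILE PROVES (kernel, 0 sorry, theorems only, no `def`).
* §1 `proj325_apply_eq_zero_iff_exists` (modules over any ring; hypotheses `g_left`, `g_right`, `c_left` only),
  `proj325_apply_eq_iff_exists` (the source form: R f = f′ for a fixed point f′ of R ⟺ ∃ μ, Δ(f − f′) = Q′\*μ).
* §2 `R325_eq_zero_iff_exists`, `R325_eq_iff_exists` (for `B9Eq325Proj.Data`), `isLandauBG_of_exists` (Δ symmetric, Q′\*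
  adjoint: multiplier ⇒ variational, no inverses), `isLandauBG_iff_exists`, `landauSpace_eq`, `isLandauSrc_iff_exists`.
* §3 `landauBGL_iff_exists`, `landau138L_iff_exists`, `landau146L_iff_exists` on the lattice carriers, hypothesis-free but
  for the structural data of `B9Thm311Lattice.obvious_311_lattice` (injective transports, positive bond weights, a block
  system).

HONEST SCOPE.  Linear algebra only; nothing about existence, uniqueness or size of solutions of (1.38) (Theorems 2/4/8),
nothing about the bounds of [4]; the concrete `ℤᵈ × 𝔸` instance of the multiplier predicate (the transpose stencil Q′ᵀ of
`B7Eq78Linearization.QprimeIter` and the Dirichlet covariant Laplacian on Ω₀) is NOT defined here (definition lane).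
Count-neutral; N05 is not discharged by this file; nothing continuum / ℝ⁴ / OS / mass-gap / Clay.  Unit
`pub-ymgap-dag-n05-a` (g4), 2026-08-26.  Tree API by name only, nothing restated.
-/

namespace Literature.MathematicalPhysics.QuantumFieldTheory.Balaban1983to89.B8Eq138Multiplier

open B9Eq325Proj B9Thm311Lattice B8Eq127LandauGauge
open scoped InnerProductSpace

noncomputable section

/-! ## §1  Modules over any ring: «(I − G′Q′\*C Q′G′) f = 0 ⟺ Δ f ∈ Ran Q′\*» from the inverse laws alone -/

section Module

variable {R : Type*} [Ring R] {E F : Type*} [AddCommGroup E] [Module R E] [AddCommGroup F] [Module R F]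
variable {Δ : E →ₗ[R] E} {q : E →ₗ[R] F} {qs : F →ₗ[R] E} {A : F →ₗ[R] F} {g : E →ₗ[R] E} {c : F →ₗ[R] F}

/-- **THE LAGRANGE-MULTIPLIER FORM OF «R f = 0»** for the operator R = I − G′Q′\*(Q′G′²Q′\*)^{−1}Q′G′ of [4] (3.25), over an
ARBITRARY ring of scalars and arbitrary modules: if G′ (`g`) is a two-sided inverse of Δ′_a = Δ + Q′\*aQ′ (`g_left`,
`g_right`) and `c` is a left inverse of Q′G′²Q′\* (`c_left`), then `f − G′Q′\*c Q′G′ f = 0 ⟺ ∃ μ, Δ f = Q′\* μ`.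
(«⇒»: apply Δ′_a to f = G′Q′\*ν and move Q′\*aQ′f to the right; «⇐»: Δ′_a f = Q′\*(μ + aQ′f), so f = G′Q′\*ν′ and
c Q′G′f = c Q′G′²Q′\*ν′ = ν′.)  No scalar product, symmetry, positivity or completeness enters.
[cite: Balaban1985BackgroundPropagators, (3.24)–(3.25) p.394; Balaban1985RegularSpaces, (1.38) p.82] -/
theorem proj325_apply_eq_zero_iff_exists
    (g_left : ∀ x : E, g (Δ x + qs (A (q x))) = x) (g_right : ∀ x : E, Δ (g x) + qs (A (q (g x))) = x)
    (c_left : ∀ φ : F, c (q (g (g (qs φ)))) = φ) (f : E) :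
    f - g (qs (c (q (g f)))) = 0 ↔ ∃ μ : F, Δ f = qs μ := by
  constructor
  · intro h
    have hf : f = g (qs (c (q (g f)))) := sub_eq_zero.mp h
    refine ⟨c (q (g f)) - A (q f), ?_⟩
    have h1 := g_right (qs (c (q (g f))))
    rw [← hf] at h1
    rw [map_sub, ← h1, add_sub_cancel_right]
  · rintro ⟨μ, hμ⟩
    have h1 : f = g (qs (μ + A (q f))) := by
      have := g_left f
      rw [hμ, ← map_add] at this
      exact this.symm
    have h2 : c (q (g f)) = μ + A (q f) := by
      conv_lhs => rw [h1]
      exact c_left _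
    rw [h2, ← h1, sub_self]

/-- **The source form**: for `f′` a fixed point of R (i.e. `f′ − G′Q′\*c Q′G′f′ = f′` — on the printed side: `f′ ∈ Ran R =
Δ^η_{U₀}N(Q′(U₀))`, "f from the space R(U₀)", (1.146)), `R f = f′ ⟺ ∃ μ, Δ (f − f′) = Q′\* μ` — by linearity from the
`= 0` case. [cite: Balaban1985RegularSpaces, (1.146) p.101; Balaban1985BackgroundPropagators, (3.25) p.394] -/
theorem proj325_apply_eq_iff_exists
    (g_left : ∀ x : E, g (Δ x + qs (A (q x))) = x) (g_right : ∀ x : E, Δ (g x) + qs (A (q (g x))) = x)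
    (c_left : ∀ φ : F, c (q (g (g (qs φ)))) = φ) {f' : E} (hf' : f' - g (qs (c (q (g f')))) = f') (f : E) :
    f - g (qs (c (q (g f)))) = f' ↔ ∃ μ : F, Δ (f - f') = qs μ := by
  rw [← proj325_apply_eq_zero_iff_exists g_left g_right c_left (f - f')]
  simp only [map_sub]
  constructor
  · intro h
    rw [sub_sub_sub_comm, h, hf', sub_self]
  · intro h
    have h2 : f - g (qs (c (q (g f)))) - (f' - g (qs (c (q (g f'))))) = 0 := by
      rw [← sub_sub_sub_comm]; exact h
    rw [hf'] at h2
    exact sub_eq_zero.mp h2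

end Module

/-! ## §2  In the scalar-product setting of `B9Eq325Proj` / `B8Eq127LandauGauge` -/

section InnerProduct

variable {E F : Type*} [NormedAddCommGroup E] [InnerProductSpace ℝ E] [NormedAddCommGroup F]
  [InnerProductSpace ℝ F]
variable {Δ : E →ₗ[ℝ] E} {q : E →ₗ[ℝ] F} {qs : F →ₗ[ℝ] E} {A : F →ₗ[ℝ] F} {g : E →ₗ[ℝ] E} {c : F →ₗ[ℝ] F}

/-- **«R f = 0 ⟺ ∃ μ, Δ f = Q′\* μ» for the (3.25) operator `B9Eq325Proj.R325`** under the printed inputs `Data` (only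
its inverse laws are used). [cite: Balaban1985BackgroundPropagators, (3.25) p.394] -/
theorem R325_eq_zero_iff_exists (h : Data Δ q qs A g c) (f : E) :
    R325 q qs g c f = 0 ↔ ∃ μ : F, Δ f = qs μ := by
  rw [R325_apply]
  exact proj325_apply_eq_zero_iff_exists h.g_left (fun x => by rw [← lapA_apply]; exact h.g_right x) h.c_left f

/-- **«R f = f′ ⟺ ∃ μ, Δ(f − f′) = Q′\* μ»** for `f′ ∈ Δ^η_U N(Q′)` (= Ran R, `R325_fix_iff_mem`).
[cite: Balaban1985BackgroundPropagators, (3.21)+(3.25) p.394; Balaban1985RegularSpaces, (1.146) p.101] -/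
theorem R325_eq_iff_exists (h : Data Δ q qs A g c) {f' : E} (hf' : f' ∈ lapKer Δ q) (f : E) :
    R325 q qs g c f = f' ↔ ∃ μ : F, Δ (f - f') = qs μ := by
  have hfix : R325 q qs g c f' = f' := (h.R325_fix_iff_mem f').mpr hf'
  rw [← sub_eq_zero, ← hfix, ← map_sub, R325_eq_zero_iff_exists h, hfix]

/-- **Multiplier ⇒ variational, with NO inverses**: if Δ is symmetric and Q′\* is adjoint to Q′, then `Δ X = Q′\* μ`
implies `⟨Δλ, X⟩ = ⟨λ, Q′\*μ⟩ = ⟨Q′λ, μ⟩ = 0` for every `λ ∈ N(Q′)`, i.e. `IsLandauBG Δ q X`.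
[cite: Balaban1985RegularSpaces, (1.27) p.80] -/
theorem isLandauBG_of_exists (lap_symm : ∀ x y : E, ⟪Δ x, y⟫_ℝ = ⟪x, Δ y⟫_ℝ)
    (adj : ∀ (x : E) (φ : F), ⟪q x, φ⟫_ℝ = ⟪x, qs φ⟫_ℝ) {X : E} (hX : ∃ μ : F, Δ X = qs μ) :
    IsLandauBG Δ q X := by
  obtain ⟨μ, hμ⟩ := hX
  intro l hl
  rw [lap_symm, hμ, ← adj, hl, inner_zero_left]

/-- **(1.27)/(1.38), variational form ⟺ multiplier form** under the printed inputs of [4] (3.23)–(3.25):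
`IsLandauBG Δ q X ↔ ∃ μ, Δ X = Q′\* μ` (through r05's `isLandauBG_iff_R325_eq_zero`).
[cite: Balaban1985RegularSpaces, (1.38) p.82; Balaban1985BackgroundPropagators, (3.25) p.394] -/
theorem isLandauBG_iff_exists (h : Data Δ q qs A g c) (X : E) :
    IsLandauBG Δ q X ↔ ∃ μ : F, Δ X = qs μ := by
  rw [isLandauBG_iff_R325_eq_zero h, R325_eq_zero_iff_exists h]

/-- The Landau subspace `(Δ^η_{U₀}N(Q′(U₀)))ᗮ` is the preimage of `Ran Q′\*` under Δ (printed inputs of [4]).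
[cite: Balaban1985RegularSpaces, (1.27) p.80] -/
theorem mem_landauSpace_iff_exists (h : Data Δ q qs A g c) (X : E) :
    X ∈ landauSpace Δ q ↔ Δ X ∈ LinearMap.range qs := by
  rw [mem_landauSpace_iff, isLandauBG_iff_exists h, LinearMap.mem_range]
  exact ⟨fun ⟨μ, hμ⟩ => ⟨μ, hμ.symm⟩, fun ⟨μ, hμ⟩ => ⟨μ, hμ.symm⟩⟩

/-- **(1.146), source form ⟺ multiplier form**: `IsLandauSrc Δ q f X ↔ f ∈ Δ^η_{U₀}N(Q′(U₀)) ∧ ∃ μ, Δ (X − f) = Q′\* μ`.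
[cite: Balaban1985RegularSpaces, (1.146) p.101] -/
theorem isLandauSrc_iff_exists (h : Data Δ q qs A g c) (f X : E) :
    IsLandauSrc Δ q f X ↔ f ∈ lapKer Δ q ∧ ∃ μ : F, Δ (X - f) = qs μ := by
  unfold IsLandauSrc
  rw [isLandauBG_iff_exists h]

end InnerProduct

/-! ## §3  On the lattice carriers of [4] (`B9Thm311Lattice`): the multiplier form outright, for every background -/

section Lattice

variable {X : Type*} {Y : Type*} {V : Type*} [NormedAddCommGroup V] [InnerProductSpace ℝ V]
variable [Fintype X] [Fintype Y] [FiniteDimensional ℝ V]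
variable (τ : X → X → V →ₗ[ℝ] V) (bonds : Finset (X × X)) (cb : X × X → ℝ) (w : Y → X → ℝ)
  (B : Y → Finset X) (Γ : Y → X → List X) (y : Y → X)

/-- **(1.27) on the lattice ⟺ «Δ^η_{U₀}X = Q′(U₀)\*μ for some μ on 𝔅»** — for EVERY background with injective transports,
positive bond weights and a block system: the (3.25)-data exist (`obvious_311_lattice`, taken at a ≡ 1 — the condition does
not see a), so §2 applies. [cite: Balaban1985RegularSpaces, (1.27) p.80; Balaban1985BackgroundPropagators, Thm 3.11 p.416] -/
theorem landauBGL_iff_exists (hinj : ∀ x x' : X, Function.Injective (τ x x'))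
    (hcb : ∀ b ∈ bonds, 0 < cb b) (hS : IsBlockSystem bonds w B Γ y) (Xf : PiLp 2 (fun _ : X => V)) :
    LandauBGL τ bonds cb w B Γ y Xf ↔
      ∃ μ : PiLp 2 (fun _ : Y => V), lapL τ bonds cb Xf = LinearMap.adjoint (qL τ w B Γ y) μ := by
  obtain ⟨g, c, hdata, h⟩ := landauBGL_iff_R325_eq_zero τ bonds cb w B Γ y hinj hcb hS (fun _ => 1) (fun _ => one_pos)
  rw [h Xf, R325_eq_zero_iff_exists hdata]

/-- **(1.38)/(1.42) on the lattice ⟺ «Δ^η_{U₀}(D^{η*}_{U₀}A) = Q′(U₀)\*μ for some μ»** (bond field A, X = D†A).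
[cite: Balaban1985RegularSpaces, (1.38) p.82; Balaban1985BackgroundPropagators, Thm 3.11 p.416] -/
theorem landau138L_iff_exists (hinj : ∀ x x' : X, Function.Injective (τ x x'))
    (hcb : ∀ b ∈ bonds, 0 < cb b) (hS : IsBlockSystem bonds w B Γ y) (Af : PiLp 2 (fun _ : ↥bonds => V)) :
    Landau138L τ bonds cb w B Γ y Af ↔
      ∃ μ : PiLp 2 (fun _ : Y => V),
        lapL τ bonds cb (LinearMap.adjoint (DL τ bonds cb) Af) = LinearMap.adjoint (qL τ w B Γ y) μ :=
  landauBGL_iff_exists τ bonds cb w B Γ y hinj hcb hS _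

/-- **(1.146) on the lattice ⟺ «f ∈ R(U₀) ∧ Δ^η_{U₀}(D^{η*}_{U₀}A − f) = Q′(U₀)\*μ for some μ»** (Theorem 8's source form).
[cite: Balaban1985RegularSpaces, (1.146) p.101; Balaban1985BackgroundPropagators, Thm 3.11 p.416] -/
theorem landau146L_iff_exists (hinj : ∀ x x' : X, Function.Injective (τ x x'))
    (hcb : ∀ b ∈ bonds, 0 < cb b) (hS : IsBlockSystem bonds w B Γ y) (f : PiLp 2 (fun _ : X => V))
    (Af : PiLp 2 (fun _ : ↥bonds => V)) :
    Landau146L τ bonds cb w B Γ y f Af ↔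
      f ∈ lapKer (lapL τ bonds cb) (qL τ w B Γ y) ∧
        ∃ μ : PiLp 2 (fun _ : Y => V),
          lapL τ bonds cb (LinearMap.adjoint (DL τ bonds cb) Af - f) = LinearMap.adjoint (qL τ w B Γ y) μ := by
  obtain ⟨g, c, hdata, -⟩ := landauBGL_iff_R325_eq_zero τ bonds cb w B Γ y hinj hcb hS (fun _ => 1) (fun _ => one_pos)
  exact isLandauSrc_iff_exists hdata f _

end Lattice

#print axioms proj325_apply_eq_zero_iff_exists
#print axioms isLandauBG_iff_exists
#print axioms landau138L_iff_exists

end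

end Literature.MathematicalPhysics.QuantumFieldTheory.Balaban1983to89.B8Eq138Multiplier
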